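import Summits.HodgeConjecture.HodgeConjecture.Theses.NoetherLefschetzOneUp
import Summits.HodgeConjecture.HodgeConjecture.Theorems.NoetherLefschetzOneUpK3TypeNetsStubNetStructure
import Summits.HodgeConjecture.HodgeConjecture.Theorems.NoetherLefschetzOneUpK3TypeNetsStubFibreClassMultiple
import Summits.HodgeConjecture.HodgeConjecture.Theorems.NoetherLefschetzOneUpK3TypeNetsStubFibreClassTransport
import Literature.AlgebraicGeometry.HodgeTheory.HodgeTypeConjugation
import Literature.AlgebraicGeometry.HodgeTheory.AlgebraicClassesHodgeTypeHolds
import Literature.AlgebraicGeometry.Motives.FiberNetExistence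
import Literature.AlgebraicGeometry.Motives.SegreEmbedding

/-!
# Piece `K3TypeNetsGrantedProducts` of crux `K3TypeNets` (stmt-HodgeConjecture-11600) — birth skeleton (BC3)

Route `HodgeConjecture/NoetherLefschetzOneUp`. BC2-redirect of the RESTATED-flagged crux `K3TypeNets`
(crux-strategist r1, 2026-08-17): `K3TypeNets ⇐ PgOneProductClasses ∧ K3TypeNetsGrantedProducts`, where

* `PgOneProductClasses` (P, THE PRODUCT SECTOR): every rational `(2,2)`-class on `S₁ × S₂`, `S₁` a smooth
  projective surface with `h^{2,0} = 1`, `S₂` any smooth projective surface, is algebraic — the K3-isogeny /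
  Hodge-similarity / real-multiplication problem (Buskin 2019, Huybrechts 2019, Varesco 2023) and the
  Weil-type products of abelian surfaces; skeleton `PgOneProductClasses_birth.lean`;
* `K3TypeNetsGrantedProducts` (Q := P → K3TypeNets, THIS FILE): the crux granted the product sector.

WHY THIS CUT (lead census `Cruxes/K3TypeNets/CENSUS-c2.md` §1–2): every cell of the live Picard-constancy ×
regularity skeleton (`Lines/birth.lean` v3: S3c isogeny sector, S3j regular jumping, S4j irregular jumping)
contains `HC(2,2)` for fourfolds DOMINATED BY A PRODUCT OF TWO SURFACES one of which has `h^{2,0} = 1` —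
bi-double covers `(S × B)/(ι × τ) → ℙ²` in S3c (`Hom_Hdg(T(S), T(B))`, B ANY double plane), relative Kummer
nets `Km(E_s × E'_t)` in S3j and the refuter's `E_s × E'_t` nets on `Bl(S × S')` in S4j (RM classes in
`T(S) ⊗ T(S')`) — so no cell can close before stmt-13676/13680-type statements, and the lead parked the crux
`blocked-on: stmt-HodgeConjecture-13676`. Granting P removes EXACTLY those members from every cell (pull the
class back to a blow-up of the dominating product, apply P and the blow-up formula, push forward:
`g_* g^* = deg g`), and what is left in S3j is the route's Noether–Lefschetz thesis on its true home (nets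
with non-constant period map that are not product-dominated: `X_(3,4) ⊂ ℙ² × ℙ³`, quadric-section nets of
`Q⁴`, Kummer nets of genuinely two-parameter abelian families, …).

THE STUBS are the live v3 stubs with ONE inserted hypothesis `PgOneProductClasses` (so the lead can adopt
this file as v4 without losing the landed S1/S2a/S2b, wired in below by name exactly as in v3):

* `stub_isogenySectorGrantedProducts` (S3c|P; L/XL — NOW LARGELY CLOSABLE): Picard number constant on `U(ℂ)`
  ⇒ no NL point ⇒ period map constant (Green's density criterion, Voisin II Prop. 5.20, read backwards;
  `h^{0,2} = 1`) ⇒ for K3 and abelian fibres (global Torelli) the family is isotrivial, trivialised on a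
  finite étale cover `U' → U`, so `X` is dominated by `X_{s₀} × B'` (`B'` a smooth compactification of `U'`)
  and P applies; open residue: non-Torelli `p_g = 1` fibres (Kynev–Todorov surfaces) with constant period
  map but varying moduli.
* `stub_nlRegularJumpingGrantedProducts` (S3j|P; XL — THE HEART): the route thesis proper — NL-Gysin classes
  `G_{C,v}` over the dense NL curves (Green: a Picard jump is an NL point, `h^{2,0} = 1 < 2 = dim ℙ²`) plus
  multisections span the fibre-trivial Hodge classes modulo vertical ones; product-dominated members
  (relative Kummer nets) discharged by P.
* `stub_nlIrregularJumpingGrantedProducts` (S4j|P; XL): irregular `p_g = 1` fibres (abelian, `q = 1`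
  surfaces) with a Picard jump; the `E_s × E'_t` nets discharged by P; residue: genuinely two-parameter
  abelian-surface nets (Humbert curves as NL curves, Mordell–Weil supply of `H¹(U, R³)`).

Composition `K3TypeNetsGrantedProducts_of` (§3, no `sorry`) = the live `K3TypeNets_of` after `intro hP`, the
granted P handed to each cell. Until the route split lands the piece decls are LOCAL defs with the exact
one-line statements of `children.json`; afterwards they are the route decls by `Iff.rfl`.

## References

* [Arapura2022] D. Arapura, *Hodge cycles and the Leray filtration*, Pacific J. Math. 319 (2022), Cor. 1.4, Rmk. 1.6.
* [VoisinHodgeII2003] C. Voisin, *Hodge Theory and Complex Algebraic Geometry II*, Prop. 5.20, §4.3.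
* [Buskin2019] N. Buskin, *Every rational Hodge isometry between two K3 surfaces is algebraic*, Crelle 755 (2019), Thm 1.1.
* [Huybrechts2019] D. Huybrechts, *Motives of isogenous K3 surfaces*, Comment. Math. Helv. 94 (2019), Thm 0.2, Rem. 3.3.
* [Varesco2023] M. Varesco, arXiv:2304.02519, Introduction, Thm 2.1. [VanGeemen2008RM] B. van Geemen, §3.
* [Green1989NLComponents] [Kollar1986, Thm 2.1] [Garcia2016, Thm 1.2] [DeligneHodgeIII1974, 8.2.8] — as in `Lines/birth.md`.
-/

noncomputable section

set_option linter.dupNamespace false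

open CategoryTheory AlgebraicGeometry MonoidalCategory

namespace Summit.HodgeConjecture.HodgeConjecture.Cruxes.K3TypeNetsGrantedProducts.Birth

open Literature.AlgebraicGeometry.Motives Literature.AlgebraicGeometry.HodgeTheory
open Summit.HodgeConjecture.HodgeConjecture.Theses.NoetherLefschetzOneUp (K3TypeNets)

/-! ## §0 The two pieces (local copies of the route decls-to-be; verbatim the `children.json` statements) -/

/-- PIECE P — THE PRODUCT SECTOR: `HC(2,2)` for `S₁ × S₂` (`S₁ ⊗ S₂` in `SchemeOver ℂ = Over (Spec ℂ)`),
`S₁` smooth projective surface with `h^{2,0} = 1`, `S₂` any smooth projective surface.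
[cite: Buskin2019, Thm 1.1] [cite: Varesco2023, Introduction] [cite: VanGeemen2008RM, §3] -/
def PgOneProductClasses : Prop :=
  ∀ ⦃S₁ S₂ : SchemeOver ℂ⦄, IsSmoothProjective 2 S₁ → IsSmoothProjective 2 S₂ →
    (∃ A : HodgeModel 2 S₁, Module.finrank ℂ ↥(A.hodgePQ 2 2 0) = 1) →
    ∀ c : complexBetti (S₁ ⊗ S₂) (2 * 2), IsRationalClass c → IsOfHodgeType 4 (S₁ ⊗ S₂) (2 * 2) 2 2 c →
      c ∈ algebraicClasses (S₁ ⊗ S₂) 2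

/-- PIECE Q — K3-TYPE NETS GRANTED THE PRODUCT SECTOR (this skeleton's target). [cite: Arapura2022, Cor. 1.4 and Rmk. 1.6] -/
def K3TypeNetsGrantedProducts : Prop :=
  PgOneProductClasses → K3TypeNets

/-! ## §1 The three registered stubs (`sorry` lives ONLY here); S1/S2a/S2b are the LANDED theorems of the live line -/

/-- **Stub S3c|P — the ISOGENY sector granted products** (L/XL; closable for K3/abelian fibres). The live
`stub_isogenySector` (K3-type net, non-empty smooth open `U`, fibres over `U(ℂ)` smooth projective with
`h^{2,0} = 1`, ALL with the same Picard number; a fibre-trivial rational `(2,2)`-class is `a + (c - a)`, `a`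
rational algebraic, `c - a` supported over a proper closed `C ⊊ ℙ²`) with the product sector P as an extra
hypothesis. Plan: constant Picard number ⇒ period map constant (Green / Voisin II 5.20 backwards) ⇒ finite
monodromy, isotrivial for Torelli fibres ⇒ `X` dominated by `X_{s₀} × B'` ⇒ P + blow-up formula +
`g_* g^* = deg g`. HC-implied (`a := c`, `C := ∅`). [cite: VoisinHodgeII2003, Prop. 5.20]
[cite: Buskin2019, Thm. 1.1] [cite: Huybrechts2019, Rem. 3.3] -/
theorem stub_isogenySectorGrantedProducts :
    PgOneProductClasses →
    ∀ ⦃X : SchemeOver ℂ⦄ (f : X ⟶ projectiveSpace 2 ℂ), IsSmoothProjective 4 X →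
      Function.Surjective f.left.base → GeometricallyConnected f.left →
      (∀ U : (projectiveSpace 2 ℂ).left.Opens,
        Smooth (f.left ∣_ U) → SmoothOfRelativeDimension 2 (f.left ∣_ U)) →
      ∀ U : (projectiveSpace 2 ℂ).left.Opens, U ≠ ⊥ → Smooth (f.left ∣_ U) →
        (∀ s : AlgPoints (projectiveSpace 2 ℂ) ℂ, s.pt ∈ U →
          IsSmoothProjective 2 (fiberOver f s) ∧
            ∃ A : HodgeModel 2 (fiberOver f s), Module.finrank ℂ ↥(A.hodgePQ 2 2 0) = 1) →
        (∀ s t : AlgPoints (projectiveSpace 2 ℂ) ℂ, s.pt ∈ U → t.pt ∈ U →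
          Module.finrank ℂ ↥(Submodule.span ℂ {x : complexBetti (fiberOver f s) (2 * 1) |
              IsRationalClass x ∧ IsOfHodgeType 2 (fiberOver f s) (2 * 1) 1 1 x}) =
            Module.finrank ℂ ↥(Submodule.span ℂ {x : complexBetti (fiberOver f t) (2 * 1) |
              IsRationalClass x ∧ IsOfHodgeType 2 (fiberOver f t) (2 * 1) 1 1 x})) →
        ∀ c : complexBetti X (2 * 2), IsRationalClass c → IsOfHodgeType 4 X (2 * 2) 2 2 c →
          (∀ s : AlgPoints (projectiveSpace 2 ℂ) ℂ, s.pt ∈ U →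
            complexBetti.map (fiberι f s) (2 * 2) c = 0) →
          ∃ a : complexBetti X (2 * 2), IsRationalClass a ∧ a ∈ algebraicClasses X 2 ∧
            ∃ C : Set (projectiveSpace 2 ℂ).left, IsClosed C ∧ C ≠ Set.univ ∧
              complexBetti.restrictCompl X (f.left.base ⁻¹' C) (2 * 2) (c - a) = 0 := by
  sorry

/-- **Stub S3j|P — NL support, REGULAR fibres, JUMPING Picard number, granted products** (XL — the heart of
the route's mechanism). The live `stub_nlSupportRegularJumping` with P as an extra hypothesis: the relative
Kummer nets `Km(E_s × E'_t)` (CENSUS-c2 §1) are discharged by P; what remains is the Noether–Lefschetz thesis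
for nets with non-constant period map that are not product-dominated (NL-Gysin classes over the dense NL
curves + multisections span the fibre-trivial Hodge classes modulo vertical ones; bi-type `(1,1)_B ⊗ (1,1)_𝕋`
by Kollár's vanishing over `ℙ²`; theta-series audit). HC-implied. [cite: Arapura2022, Cor. 1.4 and Rmk. 1.6]
[cite: Green1989NLComponents] [cite: Kollar1986, Thm. 2.1] [cite: Garcia2016, Thm. 1.2] -/
theorem stub_nlRegularJumpingGrantedProducts :
    PgOneProductClasses →
    ∀ ⦃X : SchemeOver ℂ⦄ (f : X ⟶ projectiveSpace 2 ℂ), IsSmoothProjective 4 X →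
      Function.Surjective f.left.base → GeometricallyConnected f.left →
      (∀ U : (projectiveSpace 2 ℂ).left.Opens,
        Smooth (f.left ∣_ U) → SmoothOfRelativeDimension 2 (f.left ∣_ U)) →
      ∀ U : (projectiveSpace 2 ℂ).left.Opens, U ≠ ⊥ → Smooth (f.left ∣_ U) →
        (∀ s : AlgPoints (projectiveSpace 2 ℂ) ℂ, s.pt ∈ U →
          IsSmoothProjective 2 (fiberOver f s) ∧
            ∃ A : HodgeModel 2 (fiberOver f s), Module.finrank ℂ ↥(A.hodgePQ 2 2 0) = 1) →
        (∀ s : AlgPoints (projectiveSpace 2 ℂ) ℂ, s.pt ∈ U →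
          ∀ A : HodgeModel 2 (fiberOver f s), Module.finrank ℂ ↥(A.hodgePQ 1 1 0) = 0) →
        (∃ s t : AlgPoints (projectiveSpace 2 ℂ) ℂ, s.pt ∈ U ∧ t.pt ∈ U ∧
          Module.finrank ℂ ↥(Submodule.span ℂ {x : complexBetti (fiberOver f s) (2 * 1) |
              IsRationalClass x ∧ IsOfHodgeType 2 (fiberOver f s) (2 * 1) 1 1 x}) ≠
            Module.finrank ℂ ↥(Submodule.span ℂ {x : complexBetti (fiberOver f t) (2 * 1) |
              IsRationalClass x ∧ IsOfHodgeType 2 (fiberOver f t) (2 * 1) 1 1 x})) →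
        ∀ c : complexBetti X (2 * 2), IsRationalClass c → IsOfHodgeType 4 X (2 * 2) 2 2 c →
          (∀ s : AlgPoints (projectiveSpace 2 ℂ) ℂ, s.pt ∈ U →
            complexBetti.map (fiberι f s) (2 * 2) c = 0) →
          ∃ a : complexBetti X (2 * 2), IsRationalClass a ∧ a ∈ algebraicClasses X 2 ∧
            ∃ C : Set (projectiveSpace 2 ℂ).left, IsClosed C ∧ C ≠ Set.univ ∧
              complexBetti.restrictCompl X (f.left.base ⁻¹' C) (2 * 2) (c - a) = 0 := by
  sorry

/-- **Stub S4j|P — NL support, IRREGULAR fibres, JUMPING Picard number, granted products** (XL). The live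
`stub_nlSupportIrregularJumping` with P as an extra hypothesis: the refuter's `E_s × E'_t` nets on
`Bl(S × S')` (RM / similarity classes in `T(S) ⊗ T(S')`) are discharged by P; residue: genuinely
two-parameter abelian-surface (and `q = 1`, `p_g = 1`) nets, Humbert curves as NL curves, Mordell–Weil supply
of `H¹(U, R³)`. HC-implied. [cite: Arapura2022, Cor. 1.4] [cite: VanGeemen2008RM, §3] [cite: Zucker1977] -/
theorem stub_nlIrregularJumpingGrantedProducts :
    PgOneProductClasses →
    ∀ ⦃X : SchemeOver ℂ⦄ (f : X ⟶ projectiveSpace 2 ℂ), IsSmoothProjective 4 X →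
      Function.Surjective f.left.base → GeometricallyConnected f.left →
      (∀ U : (projectiveSpace 2 ℂ).left.Opens,
        Smooth (f.left ∣_ U) → SmoothOfRelativeDimension 2 (f.left ∣_ U)) →
      ∀ U : (projectiveSpace 2 ℂ).left.Opens, U ≠ ⊥ → Smooth (f.left ∣_ U) →
        (∀ s : AlgPoints (projectiveSpace 2 ℂ) ℂ, s.pt ∈ U →
          IsSmoothProjective 2 (fiberOver f s) ∧
            ∃ A : HodgeModel 2 (fiberOver f s), Module.finrank ℂ ↥(A.hodgePQ 2 2 0) = 1) →
        (∃ s : AlgPoints (projectiveSpace 2 ℂ) ℂ, s.pt ∈ U ∧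
          ∃ A : HodgeModel 2 (fiberOver f s), Module.finrank ℂ ↥(A.hodgePQ 1 1 0) ≠ 0) →
        (∃ s t : AlgPoints (projectiveSpace 2 ℂ) ℂ, s.pt ∈ U ∧ t.pt ∈ U ∧
          Module.finrank ℂ ↥(Submodule.span ℂ {x : complexBetti (fiberOver f s) (2 * 1) |
              IsRationalClass x ∧ IsOfHodgeType 2 (fiberOver f s) (2 * 1) 1 1 x}) ≠
            Module.finrank ℂ ↥(Submodule.span ℂ {x : complexBetti (fiberOver f t) (2 * 1) |
              IsRationalClass x ∧ IsOfHodgeType 2 (fiberOver f t) (2 * 1) 1 1 x})) →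
        ∀ c : complexBetti X (2 * 2), IsRationalClass c → IsOfHodgeType 4 X (2 * 2) 2 2 c →
          (∀ s : AlgPoints (projectiveSpace 2 ℂ) ℂ, s.pt ∈ U →
            complexBetti.map (fiberι f s) (2 * 2) c = 0) →
          ∃ a : complexBetti X (2 * 2), IsRationalClass a ∧ a ∈ algebraicClasses X 2 ∧
            ∃ C : Set (projectiveSpace 2 ℂ).left, IsClosed C ∧ C ≠ Set.univ ∧
              complexBetti.restrictCompl X (f.left.base ⁻¹' C) (2 * 2) (c - a) = 0 := by
  sorry

/-! ## §2 Name-keyed statements of the stubs (verbatim; the skeleton audit keys hypotheses of `_of` by name) -/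

namespace Registered

/-- Statement of `stub_isogenySectorGrantedProducts`, verbatim. -/
abbrev stub_isogenySectorGrantedProducts : Prop :=
  PgOneProductClasses →
  ∀ ⦃X : SchemeOver ℂ⦄ (f : X ⟶ projectiveSpace 2 ℂ), IsSmoothProjective 4 X →
    Function.Surjective f.left.base → GeometricallyConnected f.left →
    (∀ U : (projectiveSpace 2 ℂ).left.Opens,
      Smooth (f.left ∣_ U) → SmoothOfRelativeDimension 2 (f.left ∣_ U)) →
    ∀ U : (projectiveSpace 2 ℂ).left.Opens, U ≠ ⊥ → Smooth (f.left ∣_ U) →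
      (∀ s : AlgPoints (projectiveSpace 2 ℂ) ℂ, s.pt ∈ U →
        IsSmoothProjective 2 (fiberOver f s) ∧
          ∃ A : HodgeModel 2 (fiberOver f s), Module.finrank ℂ ↥(A.hodgePQ 2 2 0) = 1) →
      (∀ s t : AlgPoints (projectiveSpace 2 ℂ) ℂ, s.pt ∈ U → t.pt ∈ U →
        Module.finrank ℂ ↥(Submodule.span ℂ {x : complexBetti (fiberOver f s) (2 * 1) |
            IsRationalClass x ∧ IsOfHodgeType 2 (fiberOver f s) (2 * 1) 1 1 x}) =
          Module.finrank ℂ ↥(Submodule.span ℂ {x : complexBetti (fiberOver f t) (2 * 1) |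
            IsRationalClass x ∧ IsOfHodgeType 2 (fiberOver f t) (2 * 1) 1 1 x})) →
      ∀ c : complexBetti X (2 * 2), IsRationalClass c → IsOfHodgeType 4 X (2 * 2) 2 2 c →
        (∀ s : AlgPoints (projectiveSpace 2 ℂ) ℂ, s.pt ∈ U →
          complexBetti.map (fiberι f s) (2 * 2) c = 0) →
        ∃ a : complexBetti X (2 * 2), IsRationalClass a ∧ a ∈ algebraicClasses X 2 ∧
          ∃ C : Set (projectiveSpace 2 ℂ).left, IsClosed C ∧ C ≠ Set.univ ∧
            complexBetti.restrictCompl X (f.left.base ⁻¹' C) (2 * 2) (c - a) = 0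

/-- Statement of `stub_nlRegularJumpingGrantedProducts`, verbatim. -/
abbrev stub_nlRegularJumpingGrantedProducts : Prop :=
  PgOneProductClasses →
  ∀ ⦃X : SchemeOver ℂ⦄ (f : X ⟶ projectiveSpace 2 ℂ), IsSmoothProjective 4 X →
    Function.Surjective f.left.base → GeometricallyConnected f.left →
    (∀ U : (projectiveSpace 2 ℂ).left.Opens,
      Smooth (f.left ∣_ U) → SmoothOfRelativeDimension 2 (f.left ∣_ U)) →
    ∀ U : (projectiveSpace 2 ℂ).left.Opens, U ≠ ⊥ → Smooth (f.left ∣_ U) →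
      (∀ s : AlgPoints (projectiveSpace 2 ℂ) ℂ, s.pt ∈ U →
        IsSmoothProjective 2 (fiberOver f s) ∧
          ∃ A : HodgeModel 2 (fiberOver f s), Module.finrank ℂ ↥(A.hodgePQ 2 2 0) = 1) →
      (∀ s : AlgPoints (projectiveSpace 2 ℂ) ℂ, s.pt ∈ U →
        ∀ A : HodgeModel 2 (fiberOver f s), Module.finrank ℂ ↥(A.hodgePQ 1 1 0) = 0) →
      (∃ s t : AlgPoints (projectiveSpace 2 ℂ) ℂ, s.pt ∈ U ∧ t.pt ∈ U ∧
        Module.finrank ℂ ↥(Submodule.span ℂ {x : complexBetti (fiberOver f s) (2 * 1) |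
            IsRationalClass x ∧ IsOfHodgeType 2 (fiberOver f s) (2 * 1) 1 1 x}) ≠
          Module.finrank ℂ ↥(Submodule.span ℂ {x : complexBetti (fiberOver f t) (2 * 1) |
            IsRationalClass x ∧ IsOfHodgeType 2 (fiberOver f t) (2 * 1) 1 1 x})) →
      ∀ c : complexBetti X (2 * 2), IsRationalClass c → IsOfHodgeType 4 X (2 * 2) 2 2 c →
        (∀ s : AlgPoints (projectiveSpace 2 ℂ) ℂ, s.pt ∈ U →
          complexBetti.map (fiberι f s) (2 * 2) c = 0) →
        ∃ a : complexBetti X (2 * 2), IsRationalClass a ∧ a ∈ algebraicClasses X 2 ∧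
          ∃ C : Set (projectiveSpace 2 ℂ).left, IsClosed C ∧ C ≠ Set.univ ∧
            complexBetti.restrictCompl X (f.left.base ⁻¹' C) (2 * 2) (c - a) = 0

/-- Statement of `stub_nlIrregularJumpingGrantedProducts`, verbatim. -/
abbrev stub_nlIrregularJumpingGrantedProducts : Prop :=
  PgOneProductClasses →
  ∀ ⦃X : SchemeOver ℂ⦄ (f : X ⟶ projectiveSpace 2 ℂ), IsSmoothProjective 4 X →
    Function.Surjective f.left.base → GeometricallyConnected f.left →
    (∀ U : (projectiveSpace 2 ℂ).left.Opens,
      Smooth (f.left ∣_ U) → SmoothOfRelativeDimension 2 (f.left ∣_ U)) →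
    ∀ U : (projectiveSpace 2 ℂ).left.Opens, U ≠ ⊥ → Smooth (f.left ∣_ U) →
      (∀ s : AlgPoints (projectiveSpace 2 ℂ) ℂ, s.pt ∈ U →
        IsSmoothProjective 2 (fiberOver f s) ∧
          ∃ A : HodgeModel 2 (fiberOver f s), Module.finrank ℂ ↥(A.hodgePQ 2 2 0) = 1) →
      (∃ s : AlgPoints (projectiveSpace 2 ℂ) ℂ, s.pt ∈ U ∧
        ∃ A : HodgeModel 2 (fiberOver f s), Module.finrank ℂ ↥(A.hodgePQ 1 1 0) ≠ 0) →
      (∃ s t : AlgPoints (projectiveSpace 2 ℂ) ℂ, s.pt ∈ U ∧ t.pt ∈ U ∧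
        Module.finrank ℂ ↥(Submodule.span ℂ {x : complexBetti (fiberOver f s) (2 * 1) |
            IsRationalClass x ∧ IsOfHodgeType 2 (fiberOver f s) (2 * 1) 1 1 x}) ≠
          Module.finrank ℂ ↥(Submodule.span ℂ {x : complexBetti (fiberOver f t) (2 * 1) |
            IsRationalClass x ∧ IsOfHodgeType 2 (fiberOver f t) (2 * 1) 1 1 x})) →
      ∀ c : complexBetti X (2 * 2), IsRationalClass c → IsOfHodgeType 4 X (2 * 2) 2 2 c →
        (∀ s : AlgPoints (projectiveSpace 2 ℂ) ℂ, s.pt ∈ U →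
          complexBetti.map (fiberι f s) (2 * 2) c = 0) →
        ∃ a : complexBetti X (2 * 2), IsRationalClass a ∧ a ∈ algebraicClasses X 2 ∧
          ∃ C : Set (projectiveSpace 2 ℂ).left, IsClosed C ∧ C ≠ Set.univ ∧
            complexBetti.restrictCompl X (f.left.base ⁻¹' C) (2 * 2) (c - a) = 0

end Registered

/-! ## §3 Glue and composition (no `sorry` from here on) -/

/-- Rational classes are stable under differences (from `IsRationalClass.add/.smul`; the tree's
`IsRationalClass.sub'` lives in a heavier file). [cite: HatcherAT2002, §3.1] -/
theorem isRationalClass_sub {Y : Type} [TopologicalSpace Y] {k : ℕ}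
    {c c' : Literature.AlgebraicTopology.SingularHomology.singularCohomology ℂ ℂ Y k}
    (hc : IsRationalClass c) (hc' : IsRationalClass c') : IsRationalClass (c - c') := by
  have h := hc.add (hc'.smul (-1))
  rwa [Rat.cast_neg, Rat.cast_one, neg_one_smul, ← sub_eq_add_neg] at h

/-- **Two non-empty opens of `ℙ²_ℂ` meet** (`ℙ²` is irreducible: smooth projective varieties are
geometrically irreducible, `IsSmoothProjective.isIntegral_holds`). [folklore] -/
theorem inf_ne_bot_of_projectiveSpace {V W : (projectiveSpace 2 ℂ).left.Opens}
    (hV : (V : Set (projectiveSpace 2 ℂ).left).Nonempty)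
    (hW : (W : Set (projectiveSpace 2 ℂ).left).Nonempty) : V ⊓ W ≠ ⊥ := by
  haveI : IsIntegral (projectiveSpace 2 ℂ).left :=
    IsSmoothProjective.isIntegral_holds (isSmoothProjective_projectiveSpace_holds ℂ 2)
  rw [ne_eq, ← TopologicalSpace.Opens.coe_eq_empty, TopologicalSpace.Opens.coe_inf, ← ne_eq,
    ← Set.nonempty_iff_ne_empty]
  exact nonempty_preirreducible_inter V.isOpen W.isOpen hV hW

/-- **The piece `K3TypeNetsGrantedProducts` from the three OPEN stubs** (kernel-checked, no `sorry`; verbatim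
the live composition `K3TypeNets_of` of `Cruxes/K3TypeNets/Lines/birth.lean` v3 after `intro hP`, the granted
product sector `hP` being handed to each cell): S1 (landed) ⇒ tautological surface net `N`, smooth open
`U := Tᶜ ⊓ N.smoothBase ≠ ⊥`; `span_le`; S2a (landed) calibrates `c` by a rational multiple of the
multisection class `σ` on one fibre, S2b (landed, Ehresmann) transports fibre-triviality over `U(ℂ)`;
`by_cases` Picard-constancy (S3c|P), else `by_cases` regularity (S3j|P / S4j|P); reassemble
`c = (q σ + a) + (c - q σ - a) ∈ algebraicClasses X 2 ⊔ V_f`. [cite: Arapura2022, Cor. 1.4 and Rmk. 1.6]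
[cite: VoisinHodgeII2003, §4.3 and Prop. 5.20] -/
theorem K3TypeNetsGrantedProducts_of (h₃ : Registered.stub_isogenySectorGrantedProducts)
    (h₄ : Registered.stub_nlRegularJumpingGrantedProducts)
    (h₅ : Registered.stub_nlIrregularJumpingGrantedProducts) :
    K3TypeNetsGrantedProducts := by
  -- the product sector is GRANTED: hand it to every cell
  intro hP
  -- the three LANDED stubs (S1, S2a, S2b) are discharged inside the proof, by name
  have h₁ := Summit.HodgeConjecture.HodgeConjecture.Theorems.stub_netStructure
  have h₂ := Summit.HodgeConjecture.HodgeConjecture.Theorems.stub_fibreClassMultiple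
  have h₂' := Summit.HodgeConjecture.HodgeConjecture.Theorems.stub_fibreClassTransport
  intro X f hX hf hT
  obtain ⟨T, hTc, hTu, hfib⟩ := hT
  -- S1: the fibration is a surface net (connected fibres, relative dimension two where smooth)
  obtain ⟨hconn, hrel⟩ := h₁ f hX hf ⟨T, hTc, hTu, fun s hs ↦ (hfib s hs).1⟩
  haveI := hconn
  -- the tautological surface net and the smooth open `U := Tᶜ ⊓ smoothBase`
  let N : SurfaceNet 2 X := SurfaceNet.ofFibration (m := 2) hX f hrel
  let U : (projectiveSpace 2 ℂ).left.Opens := ⟨Tᶜ, hTc.isOpen_compl⟩ ⊓ N.smoothBase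
  have hUT : ∀ s : AlgPoints (projectiveSpace 2 ℂ) ℂ, s.pt ∈ U → s.pt ∉ T :=
    fun s hs ↦ (TopologicalSpace.Opens.mem_inf.mp hs).1
  have hUne : U ≠ ⊥ :=
    inf_ne_bot_of_projectiveSpace (Set.nonempty_compl.mpr hTu) N.smoothBase_nonempty_of_charZero
  haveI : LocallyOfFinitePresentation f.left := N.locallyOfFinitePresentation_proj
  have hUs : Smooth (f.left ∣_ U) :=
    Literature.AlgebraicGeometry.Morphisms.smooth_morphismRestrict_of_preimage_le_smoothLocus
      f.left U fun x hx ↦ N.preimage_smoothBase_le_smoothLocus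
        (show x ∈ N.proj.left ⁻¹ᵁ N.smoothBase from (TopologicalSpace.Opens.mem_inf.mp hx).2)
  have hfibU : ∀ s : AlgPoints (projectiveSpace 2 ℂ) ℂ, s.pt ∈ U →
      IsSmoothProjective 2 (fiberOver f s) ∧
        ∃ A : HodgeModel 2 (fiberOver f s), Module.finrank ℂ ↥(A.hodgePQ 2 2 0) = 1 :=
    fun s hs ↦ hfib s (hUT s hs)
  refine Submodule.span_le.mpr ?_
  rintro c ⟨hcQ, hcH⟩
  -- S2a: the multisection class `σ` and the fibrewise rational multiple
  obtain ⟨σ, hσQ, hσA, hmult⟩ := h₂ f hX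
  have hσH : IsOfHodgeType 4 X (2 * 2) 2 2 σ :=
    isOfHodgeType_of_mem_algebraicClasses_of_isSmoothProjective hX 2 hσA
  -- S2a at one point of `U(ℂ)`, transported over `U(ℂ)` by S2b
  obtain ⟨q, hq⟩ : ∃ q : ℚ, ∀ s : AlgPoints (projectiveSpace 2 ℂ) ℂ, s.pt ∈ U →
      complexBetti.map (fiberι f s) (2 * 2) (c - (q : ℂ) • σ) = 0 := by
    by_cases hne : ∃ s₀ : AlgPoints (projectiveSpace 2 ℂ) ℂ, s₀.pt ∈ U
    · obtain ⟨s₀, hs₀⟩ := hne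
      obtain ⟨q, hq₀⟩ := hmult s₀ (hfibU s₀ hs₀).1 c hcQ
      exact ⟨q, fun s hs ↦ h₂' f hX hconn hrel U hUs _ s₀ s hs₀ hs hq₀⟩
    · push Not at hne
      exact ⟨0, fun s hs ↦ (hne s hs).elim⟩
  have hc'Q : IsRationalClass (c - (q : ℂ) • σ) := isRationalClass_sub hcQ (hσQ.smul q)
  have hc'H : IsOfHodgeType 4 X (2 * 2) 2 2 (c - (q : ℂ) • σ) := hcH.sub hX (hσH.smul _)
  -- S3c / S3j / S4j: a fibre-trivial Hodge class is a multisection combination plus a class supported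
  -- over a curve — by the Picard dichotomy, then by regularity
  have key : ∃ a : complexBetti X (2 * 2), IsRationalClass a ∧ a ∈ algebraicClasses X 2 ∧
      ∃ C : Set (projectiveSpace 2 ℂ).left, IsClosed C ∧ C ≠ Set.univ ∧
        complexBetti.restrictCompl X (f.left.base ⁻¹' C) (2 * 2) (c - (q : ℂ) • σ - a) = 0 := by
    by_cases hconst : ∀ s t : AlgPoints (projectiveSpace 2 ℂ) ℂ, s.pt ∈ U → t.pt ∈ U →
        Module.finrank ℂ ↥(Submodule.span ℂ {x : complexBetti (fiberOver f s) (2 * 1) |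
            IsRationalClass x ∧ IsOfHodgeType 2 (fiberOver f s) (2 * 1) 1 1 x}) =
          Module.finrank ℂ ↥(Submodule.span ℂ {x : complexBetti (fiberOver f t) (2 * 1) |
            IsRationalClass x ∧ IsOfHodgeType 2 (fiberOver f t) (2 * 1) 1 1 x})
    · -- the isogeny sector
      exact h₃ hP f hX hf hconn hrel U hUne hUs hfibU hconst _ hc'Q hc'H hq
    · -- the Noether–Lefschetz sector
      push Not at hconst
      obtain ⟨s₁, t₁, hs₁, ht₁, hne₁⟩ := hconst
      by_cases hreg : ∀ s : AlgPoints (projectiveSpace 2 ℂ) ℂ, s.pt ∈ U →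
          ∀ A : HodgeModel 2 (fiberOver f s), Module.finrank ℂ ↥(A.hodgePQ 1 1 0) = 0
      · exact h₄ hP f hX hf hconn hrel U hUne hUs hfibU hreg ⟨s₁, t₁, hs₁, ht₁, hne₁⟩ _ hc'Q hc'H hq
      · push Not at hreg
        exact h₅ hP f hX hf hconn hrel U hUne hUs hfibU hreg ⟨s₁, t₁, hs₁, ht₁, hne₁⟩ _ hc'Q hc'H hq
  obtain ⟨a, haQ, haA, C, hCc, hCu, hCa⟩ := key
  have haH : IsOfHodgeType 4 X (2 * 2) 2 2 a :=
    isOfHodgeType_of_mem_algebraicClasses_of_isSmoothProjective hX 2 haA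
  -- the residual class is VERTICAL: a generator of the route's `V_f`
  have hv : c - (q : ℂ) • σ - a ∈ Submodule.span ℂ {c : complexBetti X (2 * 2) |
      IsRationalClass c ∧ IsOfHodgeType 4 X (2 * 2) 2 2 c ∧
        ∃ T : Set (projectiveSpace 2 ℂ).left, IsClosed T ∧ T ≠ Set.univ ∧
          complexBetti.restrictCompl X (f.left.base ⁻¹' T) (2 * 2) c = 0} :=
    Submodule.subset_span ⟨isRationalClass_sub hc'Q haQ, hc'H.sub hX haH, C, hCc, hCu, hCa⟩
  -- reassemble `c = (q • σ + a) + (c - q • σ - a)` : algebraic ⊔ vertical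
  have hdecomp : c = ((q : ℂ) • σ + a) + (c - (q : ℂ) • σ - a) := by abel
  rw [hdecomp]
  exact Submodule.add_mem _
    (Submodule.mem_sup_left (Submodule.add_mem _ (Submodule.smul_mem _ _ hσA) haA))
    (Submodule.mem_sup_right hv)

/-! ## §4 Wiring check and the bridge back to the crux -/

/-- The registered stubs feed the composition VERBATIM (inherits the three `sorry`s; not a proof). -/
theorem k3TypeNetsGrantedProducts_holds_of_stubs : K3TypeNetsGrantedProducts :=
  K3TypeNetsGrantedProducts_of stub_isogenySectorGrantedProducts stub_nlRegularJumpingGrantedProducts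
    stub_nlIrregularJumpingGrantedProducts

/-- The ASSEMBLY of the redirect (trivial seam, modus ponens): the product sector and the crux granted the
product sector give the crux `K3TypeNets` BY NAME. [cite: Arapura2022, Cor. 1.4] -/
theorem K3TypeNets_of_subs (hP : PgOneProductClasses) (hQ : K3TypeNetsGrantedProducts) : K3TypeNets :=
  hQ hP

/-- Converse: the piece is a consequence of the crux (as a sub-item must be). -/
theorem k3TypeNetsGrantedProducts_of_k3TypeNets (h : K3TypeNets) : K3TypeNetsGrantedProducts :=
  fun _ ↦ h

end Summit.HodgeConjecture.HodgeConjecture.Cruxes.K3TypeNetsGrantedProducts.Birth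

end
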